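import Summits.BirchSwinnertonDyer.BirchSwinnertonDyer.Theorems.QuadraticBranchSignedControlEtaLayerKummer
import Literature.NumberTheory.EllipticCurves.Kobayashi2003.SignedSelmer
import Literature.NumberTheory.EllipticCurves.QuadraticTwistSelmerPInfty
import Literature.NumberTheory.EllipticCurves.DiscreteH1Equiv
import HarnessLib

/-!
# Kobayashi's signed Selmer groups `Sel^±(E/K_∞)` do not depend on the Weierstrass model
# (transport along a `Γ_K`-equivariant isomorphism of the torsion modules; change of variables)

WHAT. For two Weierstrass models `W₁, W₂` over a number field `K` related by ISOMORPHISM DATA —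
a `Γ_K`-equivariant additive isomorphism `θ : W₁[p^∞] ≃ W₂[p^∞]` of the geometric `p`-primary
torsion and, for every `K`-field `E`, a `Γ_E`-equivariant isomorphism `θ_E : W₁(K̄_E) ≃ W₂(K̄_E)` of
local points compatible with the maps on points along the chosen embeddings (for a change of
variables `V • W₁ = W₂` over `K`: the tree's `primaryIso` / `twistLocalIso`,
`pointsMap_twistPointsIso`) — and for every `ℤ_p`-extension `κ` of `K` and sign `ε`, the induced
isomorphism `H¹(K_∞, W₁[p^∞]) ≃ H¹(K_∞, W₂[p^∞])` (`h1Equiv`) carries Kobayashi's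
`Sel^ε(W₁/K_∞)` (`Kobayashi2003.signedSelmerInfty`, Def. 1.1: classical conditions everywhere,
Kummer condition cut out by `E^ε(K_n·K_v)` at `v ∣ p`, union over the layers) onto `Sel^ε(W₂/K_∞)`,
`Γ_K`-equivariantly for the conjugation action (`exists_addEquiv_signedSelmerInfty_of_transportData`,
`exists_addEquiv_signedSelmerInfty_of_variableChange`). Steps: `h1Equiv` commutes with restriction
and conjugation (functoriality of compatible pairs); the classical local kernels correspond
(`mem_resKer_iff_h1Equiv_mem`); the layer points, traces and signed points `E^ε(K_n·K_v)` correspond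
under `θ_E` (equivariance; the traces are sums over the SAME coset representatives); the Kummer
condition corresponds on explicit cocycles (`map_oneCocycleClass`).

WHY (cell `bsd-potss`, K8 route `QuadraticBranchSignedControl`, support item 19611 `EtaDescentFrame`):
the ∀-form η-descent frame quantifies over EVERY `F`-model `V' = C • V_F` of the twist; seat
k8q-c3's comparison chain produces the decomposition for `V_F` itself; this file supplies the
missing model independence.

HONEST FRAMING: TOOL THEOREMS ONLY (Galois-cohomology bookkeeping, "Selmer groups are attached to
`E/K`, not to an equation") — no definition, no named Literature fact, no `sorry`, axioms standard;
UNCONDITIONAL. Nothing about BSD, (C1_η) or Kobayashi's theorems is claimed. Seat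
`bsd-potss-k8eta-c1` (prover), g0.

References: [Kobayashi2003] S. Kobayashi, Invent. Math. 152 (2003), Def. 1.1 (p. 2);
[SilvermanAEC2009] X.§4 (Selmer groups under isomorphism); [SerreGaloisCohomology1997] I.§2.4–2.5
(compatible pairs, conjugation); [GreenbergLNM1716] §1–2.
-/

set_option autoImplicit false
set_option linter.dupNamespace false

noncomputable section

open scoped Classical

open Field WeierstrassCurve NumberField IsDedekindDomain
open Literature.NumberTheory.EllipticCurves
open Literature.NumberTheory.GaloisRepresentations

universe u

namespace Summit.BirchSwinnertonDyer.BirchSwinnertonDyer.Theorems.ModelChange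

/-! ## §1 `h1Equiv` on `H¹(H, ·)` commutes with restriction and conjugation -/

section H1

variable {K : Type u} [Field K] {W₁ W₂ : WeierstrassCurve K} {p : ℕ}
  (θ : geomPrimaryTorsion W₁ p ≃+ geomPrimaryTorsion W₂ p)
  (hθ : ∀ (g : absoluteGaloisGroup K) (m : geomPrimaryTorsion W₁ p), θ (g • m) = g • θ m)

include hθ in
/-- Equivariance of `θ` for a subgroup `H ≤ Γ_K` (the action restricts). [folklore] -/
theorem subgroup_equivariant (H : Subgroup (absoluteGaloisGroup K)) (g : H) (m : geomPrimaryTorsion W₁ p) :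
    θ (g • m) = g • θ m :=
  hθ g m

/-- **`h1Equiv θ` commutes with restriction** `H¹(H', ·) → H¹(H, ·)` (`H ≤ H'`): both composites
are the map of the compatible pair `(H ↪ H', θ)`. [cite: SerreGaloisCohomology1997, I.§2.4] -/
theorem h1Equiv_resOfLe {H H' : Subgroup (absoluteGaloisGroup K)} (h : H ≤ H') (c : W₁.subgroupH1 p H') :
    h1Equiv (G := H) θ (subgroup_equivariant θ hθ H) (W₁.resOfLe p h c) =
      W₂.resOfLe p h (h1Equiv (G := H') θ (subgroup_equivariant θ hθ H') c) := by
  rw [h1Equiv_apply, h1Equiv_apply]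
  change resH1Hom _ _ _ (resH1Hom (subgroupInclusion h) (AddMonoidHom.id _) _ c) =
    resH1Hom (subgroupInclusion h) (AddMonoidHom.id _) _ (resH1Hom _ _ _ c)
  rw [resH1Hom_resH1Hom, resH1Hom_resH1Hom]
  exact congrFun (congrArg DFunLike.coe (resH1Hom_congr (by ext; rfl) (by ext; rfl) _ _)) c

/-- **`h1Equiv θ` commutes with conjugation** `conj_σ` on `H¹(H, ·)` (`H` normal): both composites
are the map of the pair `(h ↦ σ⁻¹hσ, m ↦ θ(σ•m) = σ•θ(m))`. [cite: SerreGaloisCohomology1997, I.§2.5] -/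
theorem h1Equiv_conjH1 {H : Subgroup (absoluteGaloisGroup K)} [H.Normal] (σ : absoluteGaloisGroup K)
    (c : W₁.subgroupH1 p H) :
    h1Equiv (G := H) θ (subgroup_equivariant θ hθ H) (W₁.conjH1 p H σ c) =
      W₂.conjH1 p H σ (h1Equiv (G := H) θ (subgroup_equivariant θ hθ H) c) := by
  rw [h1Equiv_apply, h1Equiv_apply]
  change resH1Hom _ _ _ (resH1Hom (subgroupConj H σ) (DistribSMul.toAddMonoidHom _ σ) _ c) =
    resH1Hom (subgroupConj H σ) (DistribSMul.toAddMonoidHom _ σ) _ (resH1Hom _ _ _ c)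
  rw [resH1Hom_resH1Hom, resH1Hom_resH1Hom]
  refine congrFun (congrArg DFunLike.coe (resH1Hom_congr (by ext; rfl) ?_ _ _)) c
  exact AddMonoidHom.ext fun m => hθ σ m

/-- `(h1Equiv θ)⁻¹ = h1Equiv θ⁻¹` (pointwise, by definition). [folklore] -/
theorem h1Equiv_symm_apply (H : Subgroup (absoluteGaloisGroup K)) (c : W₂.subgroupH1 p H) :
    (h1Equiv (G := H) θ (subgroup_equivariant θ hθ H)).symm c =
      h1Equiv (G := H) θ.symm (subgroup_equivariant θ.symm (symm_equivariant θ hθ) H) c :=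
  rfl

end H1

/-! ## §2 The local objects under an equivariant isomorphism of local points -/

section Local

variable {K : Type u} [Field K] {W₁ W₂ : WeierstrassCurve K} {p : ℕ} [Fact p.Prime]
  (κ : ZpExtension K p) {E : Type u} [Field E] [Algebra K E]
  (ι : AlgebraicClosure K →ₐ[K] AlgebraicClosure E)
  (θE : localPoints W₁ E ≃+ localPoints W₂ E)
  (hθE : ∀ (g : absoluteGaloisGroup E) (P : localPoints W₁ E), θE (g • P) = g • θE P)

include hθE in
/-- **Layer points correspond**: `θ_E P ∈ W₂(K_n·E) ↔ P ∈ W₁(K_n·E)` (fixed points of the same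
group; `θ_E` equivariant and injective). [cite: Kobayashi2003, Def. 1.1 (p. 2)] -/
theorem mem_localLayerPointsOfEmb_iff_of_equivariant (n : ℕ) (P : localPoints W₁ E) :
    θE P ∈ Kobayashi2003.localLayerPointsOfEmb κ ι W₂ n ↔
      P ∈ Kobayashi2003.localLayerPointsOfEmb κ ι W₁ n := by
  rw [Kobayashi2003.mem_localLayerPointsOfEmb_iff, Kobayashi2003.mem_localLayerPointsOfEmb_iff]
  refine forall_congr' fun τ => imp_congr_right fun _ => ?_
  rw [← hθE, θE.injective.eq_iff]

include hθE in
/-- **Traces correspond**: `θ_E (Tr_{n/m} P) = Tr_{n/m} (θ_E P)` — the two traces are sums over the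
SAME coset representatives of `Gal(K̄_E/K_m E)/Gal(K̄_E/K_n E)` (these groups do not depend on the
model). [cite: Kobayashi2003, Def. 1.1 (p. 2)] -/
theorem map_localTraceOfEmb (m n : ℕ) (P : localPoints W₁ E) :
    θE (Kobayashi2003.localTraceOfEmb κ ι W₁ m n P) = Kobayashi2003.localTraceOfEmb κ ι W₂ m n (θE P) := by
  haveI := Fintype.ofFinite (Kobayashi2003.localLayerSubgroupOfEmb κ ι m ⧸
    (Kobayashi2003.localLayerSubgroupOfEmb κ ι n).subgroupOf (Kobayashi2003.localLayerSubgroupOfEmb κ ι m))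
  rw [Kobayashi2003.localTraceOfEmb_apply, Kobayashi2003.localTraceOfEmb_apply, map_sum]
  exact Finset.sum_congr rfl fun q _ => hθE _ _

include hθE in
/-- **Kobayashi's signed points correspond**: `θ_E P ∈ E₂^ε(K_n·E) ↔ P ∈ E₁^ε(K_n·E)`.
[cite: Kobayashi2003, Def. 1.1 (p. 2)] -/
theorem mem_signedLocalPointsOfEmb_iff_of_equivariant (ε : ℤˣ) (n : ℕ) (P : localPoints W₁ E) :
    θE P ∈ Kobayashi2003.signedLocalPointsOfEmb κ ι W₂ ε n ↔
      P ∈ Kobayashi2003.signedLocalPointsOfEmb κ ι W₁ ε n := by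
  rw [Kobayashi2003.mem_signedLocalPointsOfEmb_iff, Kobayashi2003.mem_signedLocalPointsOfEmb_iff,
    mem_localLayerPointsOfEmb_iff_of_equivariant κ ι θE hθE]
  refine and_congr_right fun _ => forall_congr' fun m => forall_congr' fun _ => forall_congr' fun _ => ?_
  rw [← map_localTraceOfEmb κ ι θE hθE, mem_localLayerPointsOfEmb_iff_of_equivariant κ ι θE hθE]

end Local

/-! ## §3 The local conditions on `H¹(H, ·)` under transport data -/

section Conditions

variable {K : Type u} [Field K] {W₁ W₂ : WeierstrassCurve K} {p : ℕ}
  (θ : geomPrimaryTorsion W₁ p ≃+ geomPrimaryTorsion W₂ p)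
  (hθ : ∀ (g : absoluteGaloisGroup K) (m : geomPrimaryTorsion W₁ p), θ (g • m) = g • θ m)
  {E : Type u} [Field E] [Algebra K E]
  (θE : localPoints W₁ E ≃+ localPoints W₂ E)
  (hθE : ∀ (g : absoluteGaloisGroup E) (P : localPoints W₁ E), θE (g • P) = g • θE P)
  (hsq : ∀ m : geomPrimaryTorsion W₁ p,
    pointsMap W₂ E ((θ m : geomPrimaryTorsion W₂ p) : WeierstrassCurve.geomPoints W₂) =
      θE (pointsMap W₁ E (m : WeierstrassCurve.geomPoints W₁)))

include hsq in
/-- The compatibility square for the inverse data `(θ⁻¹, θ_E⁻¹)`. [folklore] -/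
theorem hsq_symm (m : geomPrimaryTorsion W₂ p) :
    pointsMap W₁ E ((θ.symm m : geomPrimaryTorsion W₁ p) : WeierstrassCurve.geomPoints W₁) =
      θE.symm (pointsMap W₂ E (m : WeierstrassCurve.geomPoints W₂)) := by
  rw [AddEquiv.eq_symm_apply, ← hsq, AddEquiv.apply_symm_apply]

include hθE hsq in
/-- **The classical local kernels correspond** under `h1Equiv θ`: `c` dies in `H¹(H_E, W₁(K̄_E))` iff
`θ_* c` dies in `H¹(H_E, W₂(K̄_E))` (`mem_resKer_iff_h1Equiv_mem` for the square `hsq`).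
[cite: SilvermanAEC2009, X.§4] [cite: GreenbergLNM1716, §2] -/
theorem mem_localKerOver_iff (H : Subgroup (absoluteGaloisGroup K)) (c : W₁.subgroupH1 p H) :
    c ∈ W₁.localKerOver p H E ↔
      h1Equiv (G := H) θ (subgroup_equivariant θ hθ H) c ∈ W₂.localKerOver p H E :=
  mem_resKer_iff_h1Equiv_mem (resGalSubgroup H E)
    ((pointsMap W₁ E).comp (geomPrimaryTorsion W₁ p).subtype) _
    ((pointsMap W₂ E).comp (geomPrimaryTorsion W₂ p).subtype) _
    θ (subgroup_equivariant θ hθ H) θE (fun x n => hθE x n) (fun m => hsq m) c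

include hθE hsq in
/-- **The Kummer condition is carried along** (one direction; the converse is this for the inverse
data): if `c = [φ]` with `ι_*(φ(τ|)) = τQ − Q` on `H_E` and `pᵏQ ∈ A₁`, then `θ_* c = [θ ∘ φ]` with
`ι_*((θ∘φ)(τ|)) = θ_E(τQ − Q) = τ(θ_E Q) − θ_E Q` and `pᵏ θ_E Q = θ_E(pᵏQ) ∈ A₂` whenever
`θ_E(A₁) ⊆ A₂`. [cite: Kobayashi2003, Def. 1.1 (p. 2); §2 p. 4 (Kummer map)] -/
theorem h1Equiv_mem_localKummerOverOfEmb (H : Subgroup (absoluteGaloisGroup K))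
    {A₁ : AddSubgroup (localPoints W₁ E)} {A₂ : AddSubgroup (localPoints W₂ E)}
    (hA : ∀ P ∈ A₁, θE P ∈ A₂) {c : W₁.subgroupH1 p H}
    (hc : c ∈ Kobayashi2003.localKummerOverOfEmb W₁ p H (closureEmb (K := K) E) A₁) :
    h1Equiv (G := H) θ (subgroup_equivariant θ hθ H) c ∈
      Kobayashi2003.localKummerOverOfEmb W₂ p H (closureEmb (K := K) E) A₂ := by
  obtain ⟨φ, Q, k, rfl, hQ, hτ⟩ := hc
  refine ⟨contOneCocycles.pullback (ContinuousMonoidHom.id H)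
      (resHomOfEquivariant (ContinuousMonoidHom.id H) (θ : geomPrimaryTorsion W₁ p →+ geomPrimaryTorsion W₂ p)
        (subgroup_equivariant θ hθ H)) φ, θE Q, k, ?_, ?_, fun τ => ?_⟩
  · rw [h1Equiv_apply]
    exact (EtaLayer.resH1Hom_oneCocycleClass _ _ _ φ).symm
  · rw [← map_nsmul]; exact hA _ hQ
  · rw [EtaLayer.pullback_resHomOfEquivariant_apply, ← hθE, ← map_sub, ← hτ τ]
    exact hsq _

end Conditions

/-! ## §4 The Selmer groups under transport data -/

section Selmer

variable {K : Type u} [Field K] [NumberField K] {W₁ W₂ : WeierstrassCurve K} {p : ℕ} [Fact p.Prime]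
  (θ : geomPrimaryTorsion W₁ p ≃+ geomPrimaryTorsion W₂ p)
  (hθ : ∀ (g : absoluteGaloisGroup K) (m : geomPrimaryTorsion W₁ p), θ (g • m) = g • θ m)
  (θE : ∀ (E : Type u) [Field E] [Algebra K E], localPoints W₁ E ≃+ localPoints W₂ E)
  (hθE : ∀ (E : Type u) [Field E] [Algebra K E] (g : absoluteGaloisGroup E) (P : localPoints W₁ E),
    θE E (g • P) = g • θE E P)
  (hsq : ∀ (E : Type u) [Field E] [Algebra K E] (m : geomPrimaryTorsion W₁ p),
    pointsMap W₂ E ((θ m : geomPrimaryTorsion W₂ p) : WeierstrassCurve.geomPoints W₂) =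
      θE E (pointsMap W₁ E (m : WeierstrassCurve.geomPoints W₁)))

omit [Fact p.Prime] in
include hθE hsq in
/-- **The classical Selmer groups `Sel_{p^∞}(W_i/K̄^H)` correspond** under `h1Equiv θ` (place by
place, conjugate by conjugate: §1 and `mem_localKerOver_iff`). [cite: SilvermanAEC2009, X.§4]
[cite: GreenbergLNM1716, §2] -/
theorem mem_selmerGroupOver_iff (H : Subgroup (absoluteGaloisGroup K)) [H.Normal] (c : W₁.subgroupH1 p H) :
    c ∈ W₁.selmerGroupOver p H ↔
      h1Equiv (G := H) θ (subgroup_equivariant θ hθ H) c ∈ W₂.selmerGroupOver p H := by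
  rw [WeierstrassCurve.mem_selmerGroupOver_iff, WeierstrassCurve.mem_selmerGroupOver_iff]
  refine and_congr (forall_congr' fun v => forall_congr' fun σ => ?_)
    (forall_congr' fun w => forall_congr' fun σ => ?_)
  · rw [mem_localKerOver_iff θ hθ (θE _) (hθE _) (hsq _) H, h1Equiv_conjH1 θ hθ]
  · rw [mem_localKerOver_iff θ hθ (θE _) (hθE _) (hsq _) H, h1Equiv_conjH1 θ hθ]

include hθE hsq in
/-- **Kobayashi's `Sel^ε(W_i/K_n)` is carried along** (one direction). [cite: Kobayashi2003, Def. 1.1 (p. 2)] -/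
theorem h1Equiv_mem_signedSelmerLayer (κ : ZpExtension K p) (ε : ℤˣ) (n : ℕ)
    {c : W₁.subgroupH1 p (κ.layerSubgroup n)} (hc : c ∈ Kobayashi2003.signedSelmerLayer W₁ κ ε n) :
    h1Equiv (G := κ.layerSubgroup n) θ (subgroup_equivariant θ hθ _) c ∈
      Kobayashi2003.signedSelmerLayer W₂ κ ε n := by
  rw [Kobayashi2003.mem_signedSelmerLayer_iff] at hc ⊢
  refine ⟨(mem_selmerGroupOver_iff θ hθ θE hθE hsq _ c).mp hc.1, fun v hv σ => ?_⟩
  rw [← h1Equiv_conjH1 θ hθ]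
  exact h1Equiv_mem_localKummerOverOfEmb θ hθ (θE _) (hθE _) (hsq _) _
    (fun P hP => (mem_signedLocalPointsOfEmb_iff_of_equivariant κ _ (θE _) (hθE _) ε n P).mpr hP)
    (hc.2 v hv σ)

include hθE hsq in
/-- **Kobayashi's `Sel^ε(W_i/K_∞)` is carried along** (one direction): a class coming from
`Sel^ε(W₁/K_n)` goes to the image of the corresponding class of `Sel^ε(W₂/K_n)` (`h1Equiv` commutes
with the maps to the top, `h1Equiv_resOfLe`). [cite: Kobayashi2003, Def. 1.1 (p. 2)] -/
theorem h1Equiv_mem_signedSelmerInfty (κ : ZpExtension K p) (ε : ℤˣ)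
    {s : W₁.subgroupH1 p κ.kerSubgroup} (hs : s ∈ Kobayashi2003.signedSelmerInfty W₁ κ ε) :
    h1Equiv (G := κ.kerSubgroup) θ (subgroup_equivariant θ hθ _) s ∈
      Kobayashi2003.signedSelmerInfty W₂ κ ε := by
  refine AddSubgroup.iSup_induction
    (fun n => (Kobayashi2003.signedSelmerLayer W₁ κ ε n).map (W₁.layerToInfty κ n))
    (C := fun s => h1Equiv (G := κ.kerSubgroup) θ (subgroup_equivariant θ hθ _) s ∈
      Kobayashi2003.signedSelmerInfty W₂ κ ε) hs ?_ ?_ ?_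
  · rintro n s ⟨c, hc, rfl⟩
    refine Kobayashi2003.map_layerToInfty_signedSelmerLayer_le W₂ κ ε n
      ⟨h1Equiv (G := κ.layerSubgroup n) θ (subgroup_equivariant θ hθ _) c,
        h1Equiv_mem_signedSelmerLayer θ hθ θE hθE hsq κ ε n hc, ?_⟩
    exact (h1Equiv_resOfLe θ hθ (κ.kerSubgroup_le_layerSubgroup n) c).symm
  · rw [map_zero]; exact zero_mem _
  · intro s t hs ht; rw [map_add]; exact add_mem hs ht

include hθE hsq in
/-- **Membership iff** (the converse is the direct statement for the inverse data `(θ⁻¹, θ_E⁻¹)`).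
[cite: Kobayashi2003, Def. 1.1 (p. 2)] -/
theorem mem_signedSelmerInfty_iff (κ : ZpExtension K p) (ε : ℤˣ) (s : W₁.subgroupH1 p κ.kerSubgroup) :
    s ∈ Kobayashi2003.signedSelmerInfty W₁ κ ε ↔
      h1Equiv (G := κ.kerSubgroup) θ (subgroup_equivariant θ hθ _) s ∈
        Kobayashi2003.signedSelmerInfty W₂ κ ε := by
  refine ⟨h1Equiv_mem_signedSelmerInfty θ hθ θE hθE hsq κ ε, fun h => ?_⟩
  have h' := h1Equiv_mem_signedSelmerInfty θ.symm (symm_equivariant θ hθ) (fun E _ _ => (θE E).symm)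
    (fun E _ _ => symm_equivariant (θE E) (hθE E)) (fun E _ _ m => hsq_symm θ (θE E) (hsq E) m) κ ε h
  rwa [← h1Equiv_symm_apply θ hθ, AddEquiv.symm_apply_apply] at h'

include hθE hsq in
/-- **`Sel^ε(W₁/K_∞) ≃ Sel^ε(W₂/K_∞)`, `Γ_K`-equivariantly**, for transport data `(θ, θ_E)`: the
restriction of `h1Equiv θ` (on `H¹(K_∞, ·)` it is `θ_*`, and it intertwines `conj_σ` for every
`σ ∈ Γ_K`). [cite: Kobayashi2003, Def. 1.1 (p. 2)] [cite: SilvermanAEC2009, X.§4] -/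
theorem exists_addEquiv_signedSelmerInfty_of_transportData (κ : ZpExtension K p) (ε : ℤˣ) :
    ∃ Ψ : Kobayashi2003.signedSelmerInfty W₁ κ ε ≃+ Kobayashi2003.signedSelmerInfty W₂ κ ε,
      (∀ s, ((Ψ s : Kobayashi2003.signedSelmerInfty W₂ κ ε) : W₂.subgroupH1 p κ.kerSubgroup) =
        h1Equiv (G := κ.kerSubgroup) θ (subgroup_equivariant θ hθ _) s) ∧
      ∀ (σ : absoluteGaloisGroup K) (s : Kobayashi2003.signedSelmerInfty W₁ κ ε),
        ((Ψ ⟨W₁.conjH1 p κ.kerSubgroup σ s, Kobayashi2003.conjH1_mem_signedSelmerInfty W₁ κ ε σ s.2⟩ :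
            Kobayashi2003.signedSelmerInfty W₂ κ ε) : W₂.subgroupH1 p κ.kerSubgroup) =
          W₂.conjH1 p κ.kerSubgroup σ (Ψ s) := by
  refine ⟨((h1Equiv (G := κ.kerSubgroup) θ (subgroup_equivariant θ hθ _)).addSubgroupMap
      (Kobayashi2003.signedSelmerInfty W₁ κ ε)).trans (AddEquiv.addSubgroupCongr ?_),
    fun s => rfl, fun σ s => ?_⟩
  · ext t
    constructor
    · rintro ⟨s, hs, rfl⟩
      exact (mem_signedSelmerInfty_iff θ hθ θE hθE hsq κ ε s).mp hs
    · intro ht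
      refine ⟨(h1Equiv (G := κ.kerSubgroup) θ (subgroup_equivariant θ hθ _)).symm t, ?_,
        AddEquiv.apply_symm_apply _ t⟩
      refine (mem_signedSelmerInfty_iff θ hθ θE hθE hsq κ ε _).mpr ?_
      rw [AddEquiv.apply_symm_apply]
      exact ht
  · exact h1Equiv_conjH1 θ hθ σ (s : W₁.subgroupH1 p κ.kerSubgroup)

end Selmer

/-! ## §5 Change of variables -/

section VariableChange

variable {K : Type u} [Field K] [NumberField K] {W₁ W₂ : WeierstrassCurve K} {V : VariableChange K}
  (p : ℕ) [Fact p.Prime]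

omit [NumberField K] [Fact p.Prime] in
/-- The coefficient square of a change of variables: `ι_*(θ m) = θ_E(ι_* m)` on `W₁[p^∞]`
(`pointsMap_twistPointsIso`). [cite: SilvermanAEC2009, X.§4] -/
theorem pointsMap_primaryIso (hV : V • W₁ = W₂) (E : Type u) [Field E] [Algebra K E]
    (m : geomPrimaryTorsion W₁ p) :
    pointsMap W₂ E ((primaryIso p hV m : geomPrimaryTorsion W₂ p) : WeierstrassCurve.geomPoints W₂) =
      twistLocalIso E hV (pointsMap W₁ E (m : WeierstrassCurve.geomPoints W₁)) := by
  rw [primaryIso, coe_primaryComponentCongr]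
  exact pointsMap_twistPointsIso E hV _

/-- **Kobayashi's `Sel^ε(E/K_∞)` for ISOMORPHIC models**: a change of variables `V • W₁ = W₂` over
the number field `K` induces `Sel^ε(W₁/K_∞) ≃ Sel^ε(W₂/K_∞)` (the restriction of
`h1Equiv (primaryIso p hV)`), intertwining the conjugation action of every `σ ∈ Γ_K` — for every
`ℤ_p`-extension `κ` and sign `ε`. [cite: Kobayashi2003, Def. 1.1 (p. 2)] [cite: SilvermanAEC2009, X.§4] -/
theorem exists_addEquiv_signedSelmerInfty_of_variableChange (hV : V • W₁ = W₂) (κ : ZpExtension K p)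
    (ε : ℤˣ) :
    ∃ Ψ : Kobayashi2003.signedSelmerInfty W₁ κ ε ≃+ Kobayashi2003.signedSelmerInfty W₂ κ ε,
      (∀ s, ((Ψ s : Kobayashi2003.signedSelmerInfty W₂ κ ε) : W₂.subgroupH1 p κ.kerSubgroup) =
        h1Equiv (G := κ.kerSubgroup) (primaryIso p hV)
          (subgroup_equivariant (primaryIso p hV) (primaryIso_smul p hV) _) s) ∧
      ∀ (σ : absoluteGaloisGroup K) (s : Kobayashi2003.signedSelmerInfty W₁ κ ε),
        ((Ψ ⟨W₁.conjH1 p κ.kerSubgroup σ s, Kobayashi2003.conjH1_mem_signedSelmerInfty W₁ κ ε σ s.2⟩ :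
            Kobayashi2003.signedSelmerInfty W₂ κ ε) : W₂.subgroupH1 p κ.kerSubgroup) =
          W₂.conjH1 p κ.kerSubgroup σ (Ψ s) :=
  exists_addEquiv_signedSelmerInfty_of_transportData (primaryIso p hV) (primaryIso_smul p hV)
    (fun E _ _ => twistLocalIso E hV) (fun E _ _ => twistLocalIso_smul E hV)
    (fun E _ _ => pointsMap_primaryIso p hV E) κ ε

end VariableChange

end Summit.BirchSwinnertonDyer.BirchSwinnertonDyer.Theorems.ModelChange

end
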